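import Mathlib
import Summits.CriticalPhenomena.SAWScalingLimit.Theses.SAWLoopFugacityFlow

/-!
# Sketch — crux-ideate stmt-CriticalPhenomena-4982 (SimpleSubseqLimits), ideator 3, round 1

First-lemma signatures of the three crux idea cards

* `capacity-clock` (Card 1): `UnforcedCrossingBound`, `simple_of_arc_range_of_strictGrowth`,
  `StrictRangeGrowth`, `simpleSubseqLimits_of_arc_of_growth`, `strictRangeGrowth_of_unforcedCrossingBound`;
* `slit-continuous-restriction` (Card 2): `simple_of_dense_pastFuture`;
* `hugging-release` (Card 3): `BoundaryApproachBound`, `boundaryApproachBound_of_unforcedCrossingBound`,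
  `simpleSubseqLimits_of_boundaryApproach`;

plus the shared range-level half `RangeArcCarrier` (the planner's foreseen split, value-fed) and the
packaged hypothesis `IsSAWSubseqLimit` (the crux's antecedents verbatim).  Nothing here needs to be
proved at this stage; everything must elaborate (sorries only in proofs).
-/

noncomputable section

namespace Summit.CriticalPhenomena.SAWScalingLimit.Cruxes.SimpleSubseqLimits.Sketch

open MeasureTheory Filter Topology Set
open Literature.Probability.RandomPlanarGeometry Literature.Probability.LatticeModels

/-! ## Shared packaging -/

/-- `ν` is a probability measure on curve classes that is the weak limit, along `s n → 0⁺`, of the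
pushed-forward critical `δℤ²` SAW laws of `(D; a_δ, b_δ)` — the antecedents of the crux verbatim. -/
def IsSAWSubseqLimit (D : DobrushinDomain) (a b : ℝ → Site 2) (s : ℕ → ℝ)
    (ν : Measure (CurveClass ℂ)) : Prop :=
  Tendsto s atTop (𝓝[>] 0) ∧ IsProbabilityMeasure ν ∧
    ∀ f : BoundedContinuousFunction (CurveClass ℂ) ℝ,
      Tendsto (fun n => ∫ γ, f γ.curve ∂(SAW.law D.carrier (s n) (a (s n)) (b (s n)))) atTop
        (𝓝 (∫ x, f x ∂ν))

/-- RANGE HALF of the crux (Part 1 — the planner's foreseen split "range is a simple boundary-avoiding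
arc", fed by hull-avoidance VALUES + transport of the two-sided fill + SLE_(8/3) simplicity):
`ν`-a.e. the range is the image of an injective continuous map of the unit interval from `a` to `b`,
lies in `cl D` and meets `∂D` only at `a, b`; the endpoint clauses of the crux (portmanteau on the
continuous `source`/`target`, easy) are carried along so that compositions are honest. -/
def RangeArcCarrier : Prop :=
  ∀ (D : DobrushinDomain) (a b : ℝ → Site 2), SAW.IsEndpointApprox D a b →
    ∀ (s : ℕ → ℝ) (ν : Measure (CurveClass ℂ)), IsSAWSubseqLimit D a b s ν →
      ∀ᵐ c ∂ν, (∃ e : C(unitInterval, ℂ), Function.Injective e ∧ Set.range e = c.range ∧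
          e 0 = D.pt 0 ∧ e 1 = D.pt 1) ∧ c.source = D.pt 0 ∧ c.target = D.pt 1 ∧
        c.range ⊆ closure D.carrier ∧ c.range ∩ frontier D.carrier ⊆ {D.pt 0, D.pt 1}

/-! ## Shared lattice vocabulary: unforced annulus crossings, read on the LATTICE
(Kemppainen–Smirnov 2017, §2.1, Condition G; avoidability is decided by graph connectivity of
`Ω_δ`, so that sub-mesh corridors of the continuum carrier cannot fake an "avoidable" crossing) -/

/-- The open annulus `A(z₀; r, R)`. -/
def annulus (z₀ : ℂ) (r R : ℝ) : Set ℂ := {z | r < dist z z₀ ∧ dist z z₀ < R}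

/-- Lattice sites whose mesh points lie in the annulus. -/
def annulusVerts (δ : ℝ) (z₀ : ℂ) (r R : ℝ) : Set (Site 2) := {v | meshPoint δ v ∈ annulus z₀ r R}

/-- The connected component of `v` inside the vertex set `S` of the graph `G`, as a set of sites
(empty if `v ∉ S`). -/
def compIn (G : SimpleGraph (Site 2)) (S : Set (Site 2)) (v : Site 2) : Set (Site 2) :=
  {w | ∃ (hv : v ∈ S) (hw : w ∈ S), (G.induce S).Reachable ⟨v, hv⟩ ⟨w, hw⟩}

/-- Graph-level AVOIDABILITY (KS's `Aᵘ` read on `Ω_δ`): `v ∈ S`, and deleting the whole component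
of `v` in `S` keeps the endpoints `a`, `b` joined in `G`. -/
def GraphAvoidable (G : SimpleGraph (Site 2)) (a b : Site 2) (S : Set (Site 2)) (v : Site 2) :
    Prop :=
  v ∈ S ∧ ∃ (ha : a ∉ compIn G S v) (hb : b ∉ compIn G S v),
    (G.induce (compIn G S v)ᶜ).Reachable ⟨a, ha⟩ ⟨b, hb⟩

/-- The SAW makes an UNFORCED CROSSING of `A(z₀; r, R)`: indices `i < j`, one of the two vertices
within radius `r`, the other beyond radius `R`, and every intermediate vertex a graph-avoidable
annulus site. -/
def unforcedCrossingSAW (Ω : Set ℂ) (δ : ℝ) (a b : Site 2) (z₀ : ℂ) (r R : ℝ) :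
    Set (SAW.DomainSAW Ω δ a b) :=
  {γ | ∃ i j : ℕ, i < j ∧ j ≤ γ.length ∧
    ((dist (meshPoint δ (γ.walk.getVert i)) z₀ ≤ r ∧ R ≤ dist (meshPoint δ (γ.walk.getVert j)) z₀) ∨
      (R ≤ dist (meshPoint δ (γ.walk.getVert i)) z₀ ∧ dist (meshPoint δ (γ.walk.getVert j)) z₀ ≤ r)) ∧
    ∀ k, i < k → k < j →
      GraphAvoidable (discreteDomainGraph Ω δ) a b (annulusVerts δ z₀ r R) (γ.walk.getVert k)}

/-- Card 1's lattice input = Kemppainen–Smirnov's Condition G1 (time zero) for the WHOLE family of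
critical `δℤ²` SAW two-point laws: one constant `C`, bound `1/2`, uniformly over all Dobrushin
domains, all endpoint vertices and all annuli of modulus `C` above the mesh.  The exact
domain-Markov identity of `SAW.law` (future ∣ past = the two-point law of the slit graph from the
tip) upgrades it to the conditional Condition G2 that KS's Theorem 1.3 consumes — the same estimate
the shared support `EventualTight` (stmt-CriticalPhenomena-1372) names as its tool. -/
def UnforcedCrossingBound : Prop :=
  ∃ C : ℝ, 1 < C ∧ ∃ δ₀ : ℝ, 0 < δ₀ ∧
    ∀ (D : DobrushinDomain) (a b : Site 2) (δ : ℝ), 0 < δ → δ < δ₀ →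
      ∀ (z₀ : ℂ) (r R : ℝ), δ ≤ r → C * r ≤ R →
        SAW.law D.carrier δ a b (unforcedCrossingSAW D.carrier δ a b z₀ r R) ≤ 1 / 2

/-- Card 3's lattice input: the same bound for annuli CENTRED ON THE BOUNDARY only (points of
`frontier D`; for a slit domain, points of the slit): "a critical SAW does not approach a given
boundary point within `1/C` of its distance when the geometry leaves it the choice".  No interior
(one-point density, DKY Problem 10) statement is included. -/
def BoundaryApproachBound : Prop :=
  ∃ C : ℝ, 1 < C ∧ ∃ δ₀ : ℝ, 0 < δ₀ ∧
    ∀ (D : DobrushinDomain) (a b : Site 2) (δ : ℝ), 0 < δ → δ < δ₀ →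
      ∀ z₀ ∈ frontier D.carrier, ∀ (r R : ℝ), δ ≤ r → C * r ≤ R →
        SAW.law D.carrier δ a b (unforcedCrossingSAW D.carrier δ a b z₀ r R) ≤ 1 / 2

/-- The trivial comparison: Card 1's input contains Card 3's. -/
theorem boundaryApproachBound_of_unforcedCrossingBound :
    UnforcedCrossingBound → BoundaryApproachBound := by
  rintro ⟨C, hC, δ₀, hδ₀, h⟩
  exact ⟨C, hC, δ₀, hδ₀, fun D a b δ hδ hδ' z₀ _ r R hr hR => h D a b δ hδ hδ' z₀ r R hr hR⟩

/-! ## Card 1 — capacity clock (Kemppainen–Smirnov Thm 1.3, bullet 4) -/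

/-- Card 1, deterministic glue (the "argmax lemma", PROVED below; `h1` turns out to be unnecessary): if the range of `γ` is a simple arc `e` with the
same endpoints and the range STRICTLY GROWS on every nondegenerate parameter interval (what
"half-plane capacity strictly increasing for every parametrisation" leaves on the trace), then `γ`
itself is injective, so its class is simple.  Proof idea: `f = e⁻¹ ∘ γ : [0,1] → [0,1]`; if
`f t₂ < f t₁` with `t₁ < t₂`, take `t⋆ ∈ argmax_{[0,t₂]} f`; by the intermediate value theorem
`γ[0,t⋆] ⊇ e[0, f t⋆] ⊇ γ[t⋆, t₂]`, contradicting growth on `[t⋆, t₂]`; constancy intervals are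
excluded the same way; so `f` is an increasing homeomorphism and `γ = e ∘ f`. -/
theorem simple_of_arc_range_of_strictGrowth (γ : Curve ℂ) (e : C(unitInterval, ℂ))
    (he : Function.Injective e) (hrange : Set.range e = γ.range)
    (h0 : e 0 = γ 0) (h1 : e 1 = γ 1)
    (hgrow : ∀ s t : unitInterval, s < t → ¬ (γ '' Set.Icc s t ⊆ γ '' Set.Icc 0 s)) :
    CurveClass.mk γ ∈ CurveClass.simple := by
  classical
  have hmem : ∀ t, γ t ∈ Set.range e := fun t => by rw [hrange]; exact ⟨t, rfl⟩
  let E : unitInterval ≃ Set.range e := Equiv.ofInjective e he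
  have hEcont : Continuous E := continuous_induced_rng.2 e.continuous
  have hEsymm : Continuous E.symm := Continuous.continuous_symm_of_equiv_compact_to_t2 hEcont
  let f : unitInterval → unitInterval := fun t => E.symm ⟨γ t, hmem t⟩
  have hγc : Continuous fun t : unitInterval => (⟨γ t, hmem t⟩ : Set.range e) :=
    continuous_induced_rng.2 γ.continuous
  have hf : Continuous f := hEsymm.comp hγc
  have hef : ∀ t, e (f t) = γ t := by
    intro t
    have h : ((E (f t) : Set.range e) : ℂ) = γ t := by
      show ((E (E.symm ⟨γ t, hmem t⟩) : Set.range e) : ℂ) = γ t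
      rw [Equiv.apply_symm_apply]
    rw [← h]
    rfl
  have hf0 : f 0 = 0 := he ((hef 0).trans h0.symm)
  -- real-valued copy of `f` and its extension to `ℝ` for the intermediate value theorem
  let F : unitInterval → ℝ := fun t => (f t : ℝ)
  have hF : Continuous F := continuous_subtype_val.comp hf
  let FR : ℝ → ℝ := F ∘ Set.projIcc (0 : ℝ) 1 zero_le_one
  have hFR : Continuous FR := hF.comp continuous_projIcc
  -- the key step: a point `ts < t₂` dominating `f` on `[0, t₂]` contradicts strict growth
  have key : ∀ ts t₂ : unitInterval, ts < t₂ → (∀ t : unitInterval, t ≤ t₂ → F t ≤ F ts) → False := by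
    intro ts t₂ hts hdom
    apply hgrow ts t₂ hts
    rintro _ ⟨t, ⟨hst, htt⟩, rfl⟩
    have hle : F t ≤ F ts := hdom t htt
    have hge : F 0 ≤ F t := by
      show ((f 0 : unitInterval) : ℝ) ≤ (f t : ℝ)
      rw [hf0]; exact (f t).2.1
    -- IVT for `FR` on `[0, ts]`
    have hts0 : (0 : ℝ) ≤ (ts : ℝ) := ts.2.1
    have hIVT := intermediate_value_Icc hts0 hFR.continuousOn
    have hFR0 : FR 0 = F 0 := by
      show F (Set.projIcc 0 1 zero_le_one 0) = F 0
      rw [Set.projIcc_left]; rfl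
    have hFRts : FR ts = F ts := by
      show F (Set.projIcc 0 1 zero_le_one (ts : ℝ)) = F ts
      rw [Set.projIcc_val]
    have hmemI : F t ∈ Set.Icc (FR 0) (FR ts) := by
      rw [hFR0, hFRts]; exact ⟨hge, hle⟩
    obtain ⟨x, hx, hxval⟩ := hIVT hmemI
    have hx01 : x ∈ Set.Icc (0 : ℝ) 1 := ⟨hx.1, hx.2.trans ts.2.2⟩
    set s : unitInterval := Set.projIcc 0 1 zero_le_one x with hs
    have hsx : (s : ℝ) = x := by rw [hs, Set.projIcc_of_mem _ hx01]
    have hfs : f s = f t := by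
      apply Subtype.ext
      show F s = F t
      have : FR x = F s := rfl
      rw [← this, hxval]
    refine ⟨s, ⟨bot_le, ?_⟩, ?_⟩
    · show (s : ℝ) ≤ (ts : ℝ)
      rw [hsx]; exact hx.2
    · rw [← hef, hfs, hef]
  have hmono : StrictMono f := by
    intro t₁ t₂ hlt
    by_contra hnot
    have hle : f t₂ ≤ f t₁ := not_lt.1 hnot
    have hS : IsClosed {t : unitInterval | (t : ℝ) ≤ (t₂ : ℝ)} :=
      isClosed_le continuous_subtype_val continuous_const
    obtain ⟨tm, htm, hmax⟩ :=
      hS.isCompact.exists_isMaxOn ⟨t₂, show ((t₂ : unitInterval) : ℝ) ≤ t₂ from le_rfl⟩ hF.continuousOn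
    have htm' : tm ≤ t₂ := htm
    by_cases hlt2 : tm < t₂
    · exact key tm t₂ hlt2 (fun t ht => hmax (show ((t : unitInterval) : ℝ) ≤ t₂ from ht))
    · have htm2 : tm = t₂ := le_antisymm htm' (not_lt.1 hlt2)
      refine key t₁ t₂ hlt (fun t ht => ?_)
      have h1' : F t ≤ F tm := hmax (show ((t : unitInterval) : ℝ) ≤ t₂ from ht)
      have h2' : F t₂ ≤ F t₁ := by
        show ((f t₂ : unitInterval) : ℝ) ≤ (f t₁ : ℝ)
        exact_mod_cast hle
      calc F t ≤ F tm := h1'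
        _ = F t₂ := by rw [htm2]
        _ ≤ F t₁ := h2'
  have hinj : Function.Injective γ := by
    intro a b hab
    apply hmono.injective
    apply he
    rw [hef, hef]; exact hab
  exact CurveClass.mk_mem_simple hinj

/-- Card 1, the trace of Kemppainen–Smirnov's structure theorem on subsequential SAW limits: some
representative of `ν`-a.e. class has strictly growing range on every parameter interval (KS 2017,
Thm 1.3 bullet 4: under Condition G2 the capacity of the hull is strictly increasing for any
parametrisation; a parameter interval spent inside the past range keeps the hull, hence the capacity,
constant).  For the SAW, Condition G2 is the time-zero unforced-crossing bound made uniform over all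
slit graphs by the EXACT domain-Markov identity of `SAW.law` — the estimate `EventualTight` wants. -/
def StrictRangeGrowth : Prop :=
  ∀ (D : DobrushinDomain) (a b : ℝ → Site 2), SAW.IsEndpointApprox D a b →
    ∀ (s : ℕ → ℝ) (ν : Measure (CurveClass ℂ)), IsSAWSubseqLimit D a b s ν →
      ∀ᵐ c ∂ν, ∃ γ : Curve ℂ, CurveClass.mk γ = c ∧
        ∀ u t : unitInterval, u < t → ¬ (γ '' Set.Icc u t ⊆ γ '' Set.Icc 0 u)

/-- Card 1, composition: range half + strict range growth ⇒ the crux, by the argmax lemma a.e. -/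
theorem simpleSubseqLimits_of_arc_of_growth :
    RangeArcCarrier → StrictRangeGrowth →
      Summit.CriticalPhenomena.SAWScalingLimit.Theses.SAWLoopFugacityFlow.SimpleSubseqLimits := by
  intro hR hG D a b hab s ν hs hν hlim
  have hsub : IsSAWSubseqLimit D a b s ν := ⟨hs, hν, hlim⟩
  filter_upwards [hR D a b hab s ν hsub, hG D a b hab s ν hsub] with c hc hg
  obtain ⟨⟨e, he, hrange, he0, he1⟩, hsrc, htgt, hcl, hfr⟩ := hc
  obtain ⟨γ, hγc, hgrow⟩ := hg
  refine ⟨?_, hsrc, htgt, hcl, hfr⟩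
  subst hγc
  refine simple_of_arc_range_of_strictGrowth γ e he ?_ ?_ ?_ hgrow
  · rw [hrange, CurveClass.range_mk]
  · rw [he0, ← hsrc, CurveClass.source_mk, Curve.source_def]
  · rw [he1, ← htgt, CurveClass.target_mk, Curve.target_def]

/-- Card 1, the analytic step (statement only): the time-zero unforced-crossing bound for the whole
SAW family gives strict range growth of every subsequential limit — through the exact domain-Markov
identity (Condition G1 over all slit graphs = Condition G2) and Kemppainen–Smirnov 2017, Thm 1.3
bullet 4 with Prop. 3.7 (thin-rectangle crossings cost `K e^{-cL/u}`) and Thm 3.9–3.10 (uniform tip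
structure), to be vendored as a NAMED FACT of `Literature/…` and used as a hypothesis. -/
theorem strictRangeGrowth_of_unforcedCrossingBound :
    UnforcedCrossingBound → StrictRangeGrowth := by
  sorry

/-! ## Card 2 — slit-continuous restriction (Rohde–Schramm one level down) -/

/-- Card 2, deterministic criterion (Rohde–Schramm 2005, proof of Thm 6.1, with rational times
replaced by any dense set `T` and capacity parametrisation replaced by the reparametrisation
quotient): if for a dense set of times the FUTURE range meets the PAST range only at the present
point, then `γ` is injective off its constancy intervals, hence its class is simple (collapse the
constancy intervals by a monotone reparametrisation at distance `0`). -/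
theorem simple_of_dense_pastFuture (γ : Curve ℂ) (T : Set unitInterval) (hT : Dense T)
    (h : ∀ t ∈ T, γ '' Set.Ici t ∩ γ '' Set.Iic t = {γ t}) :
    CurveClass.mk γ ∈ CurveClass.simple := by
  sorry

/-! ## Card 3 — hugging release along the retraced strand (boundary-centred annuli only) -/

/-- Card 3, composition: given the range half, a fold of length `d₀` is a retrace that hugs the
earlier strand at width `< u` for every `u > 0`; during the retrace the tip passes the past points
`x₁, x₂, …` (spaced `2Cu` along the earlier strand, chosen measurably from the past at the turning
time) and before each passage makes an unforced crossing of the boundary-centred annulus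
`A(x_{k+1}; u, Cu)` of the current slit domain (its upper half is avoidable as long as no older past
or `∂D` seals it at scale `Cu`, which the range half excludes for small `u`); the exact
domain-Markov identity and `BoundaryApproachBound` give the chain bound `2^{-⌊d₀/(2Cu)⌋}`
(Kemppainen–Smirnov 2017, proof of Prop. 3.7), and `u ↓ 0` kills the fold.  Tightness along the
converging sequence is free (Prokhorov on the Polish `CurveClass ℂ`). -/
theorem simpleSubseqLimits_of_boundaryApproach :
    BoundaryApproachBound → RangeArcCarrier →
      Summit.CriticalPhenomena.SAWScalingLimit.Theses.SAWLoopFugacityFlow.SimpleSubseqLimits := by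
  sorry

end Summit.CriticalPhenomena.SAWScalingLimit.Cruxes.SimpleSubseqLimits.Sketch
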